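import Summits.BirchSwinnertonDyer.Rank1Residual.GaloisImage.WildThreeCubeRootResidue
import HarnessLib

/-!
# The cube-root tower of the EXOTIC core as an INTEGER CERTIFICATE on the minimal model
# (cell `b2b-bsdres`, team n1011, seat p03 gen 6 — row T-b11-INST 'per-curve kernel instances of
# family (A)', the TOOL file; consumers: `WildThreeCubeRootInstances*`)

HONEST FRAMING (cell `b2b-bsdres`, run/shared/lean/b2b/bsd-rank1-residual/, verbatim in every
file): the goal of the cell is to DELETE the COMBINATION-SHAPED residual classes of the
Birch–Swinnerton-Dyer formula for ALL analytic-rank `≤ 1` elliptic curves over `ℚ` — "full BSD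
formula for every rank `≤ 1` curve in class `C`" assembled STRICTLY from published theorems — so
that the rank-`≤ 1` remainder becomes exactly the CONSTRUCTION-SHAPED classes, which are TYPED
(missing-input `Prop`s), NOT attempted. This is not "finishing BSD". Team n1011 (N10 / N11):
research route; no claim beyond the stated classes; labels UNCHANGED; nothing is booked. Theorems
only (no definition, no named fact).

## What this file proves

n1011-p02's F3c/F3d (`WildThreeCubeRootTower`, `WildThreeCubeRootResidue`) prove the `3`-adic tower
`ρ̄_{E,3} onto ⟹ ρ̄_{E,3ⁿ} onto ∀ n` on family (A) of the EXOTIC core `v₃(j − 1728) = 3`: the rows with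
`v₃(c₄) = n₄`, `v₃(c₆) = n₆`, `v₃(Δ) = n_Δ`, `2n₆ = n_Δ + 3`, `n_Δ + 6 ≤ 3n₄`, `3 ∣ n₆` and
`c₆/3^{n₆} ≡ ±2 (mod 9)`, the hypotheses being `3`-adic valuations of the RATIONAL quantities
`W.c₄, W.c₆, W.Δ`.  This file restates them as an INTEGER CERTIFICATE on an integer equation `E₀`
with `E₀.map ℤ→ℚ = W` (in particular on the cell's records currency `integralModelInt W = E₀`):

  `E₀.c₄ = 3^{n₄}·z₄`, `E₀.c₆ = 3^{n₆}·z₆`, `E₀.Δ = 3^{n_Δ}·z_Δ` with `3 ∤ z₄ z₆ z_Δ`,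
  `2n₆ = n_Δ + 3`, `n_Δ + 6 ≤ 3n₄`, `3 ∣ n₆`, `s = ±1`, `9 ∣ z₆ − 2s`

— eleven hypotheses, each decided per curve by `decide` / `norm_num` on integer literals, so that a
per-curve instance is ONE term (`WildThreeCubeRootInstances*`: the 60 EXOTIC-candidate cells of
family (A), p14 / rmap-2 g18 "60 of the 341").

* `padicValRat_three_intCast_of_eq_pow_mul` — `x = 3^m·z`, `3 ∤ z` ⟹ `v₃(x) = m` (bookkeeping);
* `towerSurj_three_of_map_eq_of_cubeRootCert` — the tower for `W = E₀.map ℤ→ℚ` (`[W.IsElliptic]` only);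
* `imageContainsSL2_three_of_map_eq_of_cubeRootCert` — Kato's (12.5.2) at `3` likewise;
* `towerSurj_three_of_intModel_of_cubeRootCert`, `imageContainsSL2_three_of_intModel_of_cubeRootCert`
  — the same in the records' currency `integralModelInt W = E₀` (`[W.IsGloballyMinimal]`);
* `not_exotic_of_tower` — the reading in the EXOTIC currency of p14's `Additive/X4Exotic*` files: a
  row whose tower follows from `surj(3)` is NOT an EXOTIC row (`¬ (surj(3) ∧ ¬ ∀ n, surj(3ⁿ))`), so a
  census seat cites `not_exotic_of_tower (towerSurj3_cubeRoot_v<L> hI)` per cell;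
* `towerSurj_three_cubeRootCert_v5400bu1` — self-test: p02's template row 5400bu1 through the new
  door (`(n₄, n₆, n_Δ) = (3, 3, 3)`, `z₆ = 200000`, `s = 1`), all eleven hypotheses by `decide`.

The EXOTIC family of record is untouched: the 20 Elkies curves (`v₃(j − 1728) = 3`,
`j ∈ {4374, −44789760, 15786448344}`) carry no cube-root certificate (p14 `X4ExoticNotCubeRoot`:
an EXOTIC pair is not a cube-root row); a cell certified through this file is, given `surj(3)`, by
definition NOT exotic — it leaves the list of EXOTIC CANDIDATES.  `imageContainsSL2_three_*` is
exactly Kato's (12.5.2) at `3`, the image hypothesis of the V20X-type UPPER-half consumers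
(`Kato2004.ImageContainsSL2 W 3`) on these rows.

Pure arithmetic over F3c/F3d (which carry the mathematics: Serre IV-23, the cube roots of `Δ` in
`ℚ(E[3])`, the `9`-torsion abscissa valuation); nothing booked; no label change; X4 stays
CONSTRUCTION-SHAPED; the census bit `surj(3)` remains a hypothesis of every instance.

References: [SerreAbelianLadic1968] IV-23 Lemma 3; [Serre1972] §5.3; [Kato2004Asterisque] (12.5.2);
[SilvermanAEC2009] III.1 (c₄, c₆, Δ under base change), VIII.8 (minimal model).
-/

noncomputable section

open scoped Classical

open WeierstrassCurve

namespace Summit.BirchSwinnertonDyer.Rank1Residual.GaloisImage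

open Literature.NumberTheory.EllipticCurves Literature.NumberTheory.GaloisRepresentations

/-- **`v₃(x) = m` for an integer `x = 3^m·z` with `3 ∤ z`**, read in `ℚ` (bookkeeping for the
certificate). [folklore] -/
theorem padicValRat_three_intCast_of_eq_pow_mul {x z : ℤ} {m : ℕ} (hx : x = 3 ^ m * z)
    (hz : ¬ (3 : ℤ) ∣ z) : padicValRat 3 (x : ℚ) = ((m : ℕ) : ℤ) := by
  haveI : Fact (Nat.Prime 3) := ⟨Nat.prime_three⟩
  have hz0 : (z : ℚ) ≠ 0 := by
    intro h; apply hz; have : z = 0 := by exact_mod_cast h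
    rw [this]; exact dvd_zero 3
  rw [hx]; push_cast
  rw [padicValRat.mul (pow_ne_zero _ three_ne_zero) hz0, padicValRat.pow,
    show padicValRat 3 (3 : ℚ) = 1 by exact_mod_cast padicValRat.self (p := 3) (by norm_num),
    padicValRat.of_int, padicValInt.eq_zero_of_not_dvd hz]
  simp

/-- **The cube-root tower from an INTEGER CERTIFICATE** on an integer equation `E₀` of `E`
(`W = E₀.map ℤ→ℚ`): `E₀.c₄ = 3^{n₄}z₄`, `E₀.c₆ = 3^{n₆}z₆`, `E₀.Δ = 3^{n_Δ}z_Δ` (`3 ∤ z₄z₆z_Δ`),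
`2n₆ = n_Δ + 3`, `n_Δ + 6 ≤ 3n₄`, `3 ∣ n₆`, `s = ±1`, `9 ∣ z₆ − 2s`, and `ρ̄_{E,3}` onto
⟹ `ρ̄_{E,3ⁿ}` onto for every `n` (p02's `towerSurj_three_of_surj_of_c₆_residue` with its seven
rational hypotheses read off the certificate).
[cite: SerreAbelianLadic1968, Ch. IV §3.4, Lemma 3 (IV-23)] [cite: Serre1972, §5.3] -/
theorem towerSurj_three_of_map_eq_of_cubeRootCert {W : WeierstrassCurve ℚ} [W.IsElliptic]
    {E₀ : WeierstrassCurve ℤ} (hW : E₀.map (Int.castRingHom ℚ) = W)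
    {n₄ n₆ nΔ : ℕ} {z₄ z₆ zΔ s : ℤ}
    (hc₄ : E₀.c₄ = 3 ^ n₄ * z₄) (hz₄ : ¬ (3 : ℤ) ∣ z₄)
    (hc₆ : E₀.c₆ = 3 ^ n₆ * z₆) (hz₆ : ¬ (3 : ℤ) ∣ z₆)
    (hΔ : E₀.Δ = 3 ^ nΔ * zΔ) (hzΔ : ¬ (3 : ℤ) ∣ zΔ)
    (hm : 2 * n₆ = nΔ + 3) (hj : nΔ + 6 ≤ 3 * n₄) (h3 : 3 ∣ n₆)
    (hs : s = 1 ∨ s = -1) (hu : (9 : ℤ) ∣ z₆ - 2 * s)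
    (hsurj : W.HasSurjectiveModNGaloisRep 3) (n : ℕ) :
    W.HasSurjectiveModNGaloisRep (3 ^ n : ℕ) := by
  subst hW
  have e₄ : (E₀.map (Int.castRingHom ℚ)).c₄ = ((E₀.c₄ : ℤ) : ℚ) := by rw [map_c₄, eq_intCast]
  have e₆ : (E₀.map (Int.castRingHom ℚ)).c₆ = ((E₀.c₆ : ℤ) : ℚ) := by rw [map_c₆, eq_intCast]
  have eΔ : (E₀.map (Int.castRingHom ℚ)).Δ = ((E₀.Δ : ℤ) : ℚ) := by rw [map_Δ, eq_intCast]
  have v₄ : padicValRat 3 (E₀.map (Int.castRingHom ℚ)).c₄ = n₄ := by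
    rw [e₄]; exact padicValRat_three_intCast_of_eq_pow_mul hc₄ hz₄
  have v₆ : padicValRat 3 (E₀.map (Int.castRingHom ℚ)).c₆ = n₆ := by
    rw [e₆]; exact padicValRat_three_intCast_of_eq_pow_mul hc₆ hz₆
  have vΔ : padicValRat 3 (E₀.map (Int.castRingHom ℚ)).Δ = nΔ := by
    rw [eΔ]; exact padicValRat_three_intCast_of_eq_pow_mul hΔ hzΔ
  have hc₆' : (E₀.map (Int.castRingHom ℚ)).c₆ = (z₆ : ℤ) * 3 ^ n₆ := by
    rw [e₆, hc₆]; push_cast; ring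
  exact towerSurj_three_of_surj_of_c₆_residue _ hsurj v₄ v₆ vΔ hm hj h3 hs
    (c₆_residue_of_int _ hc₆' hu) n

/-- **Kato's (12.5.2) at `3` from the integer certificate** (`W = E₀.map ℤ→ℚ`): the image of
`Gal(ℚ̄/ℚ(ζ_{3^∞}))` in `Aut(T₃E)` contains `SL₂(ℤ₃)`.
[cite: Kato2004Asterisque, (12.5.2) (p. 222)] [cite: SerreAbelianLadic1968, Ch. IV §3.4, Lemma 3 (IV-23)] -/
theorem imageContainsSL2_three_of_map_eq_of_cubeRootCert {W : WeierstrassCurve ℚ} [W.IsElliptic]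
    {E₀ : WeierstrassCurve ℤ} (hW : E₀.map (Int.castRingHom ℚ) = W)
    {n₄ n₆ nΔ : ℕ} {z₄ z₆ zΔ s : ℤ}
    (hc₄ : E₀.c₄ = 3 ^ n₄ * z₄) (hz₄ : ¬ (3 : ℤ) ∣ z₄)
    (hc₆ : E₀.c₆ = 3 ^ n₆ * z₆) (hz₆ : ¬ (3 : ℤ) ∣ z₆)
    (hΔ : E₀.Δ = 3 ^ nΔ * zΔ) (hzΔ : ¬ (3 : ℤ) ∣ zΔ)
    (hm : 2 * n₆ = nΔ + 3) (hj : nΔ + 6 ≤ 3 * n₄) (h3 : 3 ∣ n₆)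
    (hs : s = 1 ∨ s = -1) (hu : (9 : ℤ) ∣ z₆ - 2 * s)
    (hsurj : W.HasSurjectiveModNGaloisRep 3) :
    Kato2004.ImageContainsSL2 W 3 := by
  subst hW
  have e₄ : (E₀.map (Int.castRingHom ℚ)).c₄ = ((E₀.c₄ : ℤ) : ℚ) := by rw [map_c₄, eq_intCast]
  have e₆ : (E₀.map (Int.castRingHom ℚ)).c₆ = ((E₀.c₆ : ℤ) : ℚ) := by rw [map_c₆, eq_intCast]
  have eΔ : (E₀.map (Int.castRingHom ℚ)).Δ = ((E₀.Δ : ℤ) : ℚ) := by rw [map_Δ, eq_intCast]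
  have v₄ : padicValRat 3 (E₀.map (Int.castRingHom ℚ)).c₄ = n₄ := by
    rw [e₄]; exact padicValRat_three_intCast_of_eq_pow_mul hc₄ hz₄
  have v₆ : padicValRat 3 (E₀.map (Int.castRingHom ℚ)).c₆ = n₆ := by
    rw [e₆]; exact padicValRat_three_intCast_of_eq_pow_mul hc₆ hz₆
  have vΔ : padicValRat 3 (E₀.map (Int.castRingHom ℚ)).Δ = nΔ := by
    rw [eΔ]; exact padicValRat_three_intCast_of_eq_pow_mul hΔ hzΔ
  have hc₆' : (E₀.map (Int.castRingHom ℚ)).c₆ = (z₆ : ℤ) * 3 ^ n₆ := by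
    rw [e₆, hc₆]; push_cast; ring
  exact imageContainsSL2_three_of_surj_of_c₆_residue _ hsurj v₄ v₆ vΔ hm hj h3 hs
    (c₆_residue_of_int _ hc₆' hu)

/-- **The cube-root tower in the records' currency** `integralModelInt W = E₀` (`W` globally
minimal): the integer certificate on `E₀` and `ρ̄_{E,3}` onto ⟹ `ρ̄_{E,3ⁿ}` onto for every `n`.
[cite: SerreAbelianLadic1968, Ch. IV §3.4, Lemma 3 (IV-23)] [cite: SilvermanAEC2009, VIII.8 (minimal model)] -/
theorem towerSurj_three_of_intModel_of_cubeRootCert {W : WeierstrassCurve ℚ} [W.IsElliptic]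
    [W.IsGloballyMinimal] {E₀ : WeierstrassCurve ℤ} (hI : integralModelInt W = E₀)
    {n₄ n₆ nΔ : ℕ} {z₄ z₆ zΔ s : ℤ}
    (hc₄ : E₀.c₄ = 3 ^ n₄ * z₄) (hz₄ : ¬ (3 : ℤ) ∣ z₄)
    (hc₆ : E₀.c₆ = 3 ^ n₆ * z₆) (hz₆ : ¬ (3 : ℤ) ∣ z₆)
    (hΔ : E₀.Δ = 3 ^ nΔ * zΔ) (hzΔ : ¬ (3 : ℤ) ∣ zΔ)
    (hm : 2 * n₆ = nΔ + 3) (hj : nΔ + 6 ≤ 3 * n₄) (h3 : 3 ∣ n₆)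
    (hs : s = 1 ∨ s = -1) (hu : (9 : ℤ) ∣ z₆ - 2 * s)
    (hsurj : W.HasSurjectiveModNGaloisRep 3) (n : ℕ) :
    W.HasSurjectiveModNGaloisRep (3 ^ n : ℕ) :=
  towerSurj_three_of_map_eq_of_cubeRootCert (by rw [← hI, map_integralModelInt]) hc₄ hz₄ hc₆ hz₆ hΔ
    hzΔ hm hj h3 hs hu hsurj n

/-- **Kato's (12.5.2) at `3` in the records' currency** `integralModelInt W = E₀`.
[cite: Kato2004Asterisque, (12.5.2) (p. 222)] [cite: SerreAbelianLadic1968, Ch. IV §3.4, Lemma 3 (IV-23)] -/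
theorem imageContainsSL2_three_of_intModel_of_cubeRootCert {W : WeierstrassCurve ℚ} [W.IsElliptic]
    [W.IsGloballyMinimal] {E₀ : WeierstrassCurve ℤ} (hI : integralModelInt W = E₀)
    {n₄ n₆ nΔ : ℕ} {z₄ z₆ zΔ s : ℤ}
    (hc₄ : E₀.c₄ = 3 ^ n₄ * z₄) (hz₄ : ¬ (3 : ℤ) ∣ z₄)
    (hc₆ : E₀.c₆ = 3 ^ n₆ * z₆) (hz₆ : ¬ (3 : ℤ) ∣ z₆)
    (hΔ : E₀.Δ = 3 ^ nΔ * zΔ) (hzΔ : ¬ (3 : ℤ) ∣ zΔ)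
    (hm : 2 * n₆ = nΔ + 3) (hj : nΔ + 6 ≤ 3 * n₄) (h3 : 3 ∣ n₆)
    (hs : s = 1 ∨ s = -1) (hu : (9 : ℤ) ∣ z₆ - 2 * s)
    (hsurj : W.HasSurjectiveModNGaloisRep 3) :
    Kato2004.ImageContainsSL2 W 3 :=
  imageContainsSL2_three_of_map_eq_of_cubeRootCert (by rw [← hI, map_integralModelInt]) hc₄ hz₄ hc₆
    hz₆ hΔ hzΔ hm hj h3 hs hu hsurj

/-- **Reading in the EXOTIC currency**: if the `3`-adic tower follows from `ρ̄_{E,3}` onto (as on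
every certified cube-root row), the row is NOT EXOTIC — `¬ (ρ̄_{E,3} onto ∧ ¬ ∀ n, ρ̄_{E,3ⁿ} onto)`
(the EXOTIC hypothesis shape of p14's `Additive/X4ExoticNotCubeRoot`). Pure logic. [this work] -/
theorem not_exotic_of_tower {W : WeierstrassCurve ℚ} [W.IsElliptic]
    (h : W.HasSurjectiveModNGaloisRep 3 → ∀ n : ℕ, W.HasSurjectiveModNGaloisRep (3 ^ n : ℕ)) :
    ¬ (W.HasSurjectiveModNGaloisRep 3 ∧ ¬ ∀ n : ℕ, W.HasSurjectiveModNGaloisRep (3 ^ n : ℕ)) :=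
  fun hx => hx.2 (h hx.1)

/-! ### Self-test: p02's template row 5400bu1 `[0, 0, 0, 1125, −6250]` through the certificate door
(`c₄ = 3³·(−2000)`, `c₆ = 3³·200000`, `Δ = 3³·(−4000000000)`; `(n₄, n₆, n_Δ) = (3, 3, 3)`, `s = 1`,
`9 ∣ 200000 − 2`). -/

/-- **The `3`-adic tower for Cremona 5400bu1 (records' currency), given `ρ̄_{E,3}` onto**: every one
of the eleven certificate entries by `decide`. [this work] -/
theorem towerSurj_three_cubeRootCert_v5400bu1 {W : WeierstrassCurve ℚ} [W.IsElliptic]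
    [W.IsGloballyMinimal] (hI : integralModelInt W = ⟨0, 0, 0, 1125, -6250⟩)
    (hsurj : W.HasSurjectiveModNGaloisRep 3) (n : ℕ) : W.HasSurjectiveModNGaloisRep (3 ^ n : ℕ) :=
  towerSurj_three_of_intModel_of_cubeRootCert hI (n₄ := 3) (n₆ := 3) (nΔ := 3) (z₄ := -2000)
    (z₆ := 200000) (zΔ := -4000000000) (s := 1) (by decide +kernel) (by decide) (by decide +kernel)
    (by decide) (by decide +kernel) (by decide) (by decide) (by decide) (by decide) (Or.inl rfl)
    (by decide) hsurj n

/-- Self-test of the EXOTIC-currency reading on 5400bu1: the row is not exotic. [this work] -/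
theorem not_exotic_cubeRootCert_v5400bu1 {W : WeierstrassCurve ℚ} [W.IsElliptic]
    [W.IsGloballyMinimal] (hI : integralModelInt W = ⟨0, 0, 0, 1125, -6250⟩) :
    ¬ (W.HasSurjectiveModNGaloisRep 3 ∧ ¬ ∀ n : ℕ, W.HasSurjectiveModNGaloisRep (3 ^ n : ℕ)) :=
  not_exotic_of_tower (towerSurj_three_cubeRootCert_v5400bu1 hI)

end Summit.BirchSwinnertonDyer.Rank1Residual.GaloisImage

end
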